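import Summits.CriticalPhenomena.CardyFormulaZ2.Theorems.CardyBoundaryCoulombGasStripClusterRatesTwoClusterCardyOrderLiminf

/-!
# The two-cluster half of `StripClusterRates` implies the plain Cardy-order lower bound

Support file for line `two-cluster-rate-is-stationary-gap` (crux `StripClusterRates`,
stmt-CriticalPhenomena-13878), lead c7, stub `co_cardyOrderTwoLower_of_kacTwo` (S4).

The crux takes its limits in TRANSFER-MATRIX ORDER: `γ₂(n) = lim_m −log p₂(m,n)/m` at fixed width `n`
(`p₂(m,n)` = probability of two open LR crossings of `[0,m]×[0,n]` in distinct open clusters of the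
rectangle, bond percolation on `ℤ²` at `p = 1/2`), then `n·γ₂(n) → 2π`. This file lands the NECESSARY
half of the Cardy-order two-cluster statement CO₂: the γ₂-half of the crux implies the plain Cardy-order
LOWER bound

  `∃ G, G(A)/A → 2π ∧ ∀ A ≥ 1, ∀ᶠ n, exp(−G(A)) ≤ p₂(A·n, n)`.

Proof. Sub-multiplicativity of `p₂` in the length gives the finite-length bound
`−log p₂(m,n)/(m+1) ≤ γ₂(n)` for EVERY `m` (`rateTwo_ge_finite`, landed in
`…TwoClusterCardyOrderLiminf`). At `m = 0` it shows `γ₂(n) ≥ 0` (as `p₂ ≤ 1`); at `m = A·n` it reads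
`−log p₂(A·n,n) ≤ (A·n+1)·γ₂(n) ≤ (A+1)·(n·γ₂(n))`, and `n·γ₂(n) ≤ 2π + 1/A` eventually in `n`, so
`G(A) := (A+1)·(2π + 1/A)` works (`G(A)/A = (1 + 1/A)(2π + 1/A) → 2π`).

No definitions; `pTwo`, `rateSeqTwo` are the abbreviations of `Negative.KacFromAboveFalse`, and the
registered form `co_cardyOrderTwoLower_of_kacTwo` inlines the crux's two-cluster event verbatim.

References: [Cardy1998] eq. (bb); M. Fekete (1923).
-/

noncomputable section
open MeasureTheory Filter Topology Set
open Literature.Probability.LatticeModels Literature.Probability.Percolation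

namespace Summit.CriticalPhenomena.CardyFormulaZ2.Cruxes.StripClusterRates.TwoClusterRateIsStationaryGap

open Summit.CriticalPhenomena.CardyFormulaZ2.Theorems.StripClusterRates.Negative

/-! ## §1 Nonnegativity of the two-cluster rates -/

/-- `p₂(m,n) ≤ 1` (`bondPercolation` is a probability measure). [folklore] -/
theorem co2l_pTwo_le_one (m n : ℕ) : pTwo m n ≤ 1 :=
  measureReal_le_one

/-- `0 ≤ −log p₂(m,n)` for `n ≥ 1`. [folklore] -/
theorem co2l_negLog_pTwo_nonneg {n : ℕ} (hn : 1 ≤ n) (m : ℕ) : 0 ≤ -Real.log (pTwo m n) := by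
  have h := Real.log_nonpos (co_pTwo_pos hn m).le (co2l_pTwo_le_one m n)
  linarith

/-- **The two-cluster rates are nonnegative**: every limit `γ` of `−log p₂(m,n)/m` satisfies `0 ≤ γ`
(`rateTwo_ge_finite` at `m = 0`). [folklore] -/
theorem co2l_rateTwo_nonneg {n : ℕ} (hn : 1 ≤ n) {γ : ℝ} (h : Tendsto (rateSeqTwo n) atTop (𝓝 γ)) :
    0 ≤ γ := by
  have h0 := rateTwo_ge_finite hn h 0
  have h1 := co2l_negLog_pTwo_nonneg hn 0
  push_cast at h0
  rw [zero_add, div_one] at h0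
  linarith

/-! ## §2 The finite-`n` Cardy-order bound at integer aspect ratio `A` -/

/-- **Finite-`n` Cardy-order bound**: `−log p₂(A·n, n) ≤ (A+1)·(n·γ₂(n))` for `n ≥ 1` and every
limit `γ₂(n)` of the rate sequence (`rateTwo_ge_finite` at `m = A·n`, `A·n + 1 ≤ (A+1)·n`,
`γ₂(n) ≥ 0`). [folklore] -/
theorem co2l_negLog_pTwo_aspect_le {n : ℕ} (hn : 1 ≤ n) {γ : ℝ}
    (h : Tendsto (rateSeqTwo n) atTop (𝓝 γ)) (A : ℕ) :
    -Real.log (pTwo (A * n) n) ≤ ((A : ℝ) + 1) * ((n : ℝ) * γ) := by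
  have hfin := rateTwo_ge_finite hn h (A * n)
  have hγ := co2l_rateTwo_nonneg hn h
  have hden : (0 : ℝ) < ((A * n : ℕ) : ℝ) + 1 := by positivity
  rw [div_le_iff₀ hden] at hfin
  have hn' : (1 : ℝ) ≤ n := by exact_mod_cast hn
  have hcast : ((A * n : ℕ) : ℝ) = (A : ℝ) * n := by push_cast; ring
  rw [hcast] at hfin
  calc -Real.log (pTwo (A * n) n) ≤ γ * ((A : ℝ) * n + 1) := hfin
    _ ≤ γ * ((A : ℝ) * n + n) := by gcongr
    _ = ((A : ℝ) + 1) * ((n : ℝ) * γ) := by ring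

/-! ## §3 The Cardy-order lower bound with `G(A) = (A+1)(2π + 1/A)` -/

/-- `G(A)/A → 2π` for `G(A) = (A+1)·(2π + 1/A)`. [folklore] -/
theorem co2l_tendsto_G_div :
    Tendsto (fun A : ℕ ↦ ((A : ℝ) + 1) * (2 * Real.pi + 1 / (A : ℝ)) / A) atTop (𝓝 (2 * Real.pi)) := by
  have h1 : Tendsto (fun A : ℕ ↦ 1 / (A : ℝ)) atTop (𝓝 0) := tendsto_one_div_atTop_nhds_zero_nat
  have h : Tendsto (fun A : ℕ ↦ (1 + 1 / (A : ℝ)) * (2 * Real.pi + 1 / (A : ℝ))) atTop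
      (𝓝 ((1 + 0) * (2 * Real.pi + 0))) :=
    (tendsto_const_nhds.add h1).mul (tendsto_const_nhds.add h1)
  rw [add_zero, add_zero, one_mul] at h
  refine h.congr' ?_
  filter_upwards [eventually_ge_atTop 1] with A hA
  have : (A : ℝ) ≠ 0 := by exact_mod_cast Nat.one_le_iff_ne_zero.mp hA
  field_simp

/-- **The γ₂-half of the crux implies the plain Cardy-order lower bound** (`pTwo` form): if
`−log p₂(m,n)/m → γ₂(n)` for every width `n ≥ 1` and `n·γ₂(n) → 2π`, then with
`G(A) := (A+1)·(2π + 1/A)` one has `G(A)/A → 2π` and, for every integer aspect ratio `A ≥ 1`,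
`exp(−G(A)) ≤ p₂(A·n, n)` eventually in `n`. [cite: Cardy1998, eq. (bb)] -/
theorem co2l_cardyOrderTwoLower {γ₂ : ℕ → ℝ}
    (h₂ : ∀ n : ℕ, 1 ≤ n → Tendsto (rateSeqTwo n) atTop (𝓝 (γ₂ n)))
    (hK : Tendsto (fun n : ℕ ↦ (n : ℝ) * γ₂ n) atTop (𝓝 (2 * Real.pi))) :
    ∃ G : ℕ → ℝ, Tendsto (fun A : ℕ ↦ G A / A) atTop (𝓝 (2 * Real.pi)) ∧
      ∀ A : ℕ, 1 ≤ A → ∀ᶠ n : ℕ in atTop, Real.exp (-G A) ≤ pTwo (A * n) n := by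
  refine ⟨fun A ↦ ((A : ℝ) + 1) * (2 * Real.pi + 1 / (A : ℝ)), co2l_tendsto_G_div, fun A hA ↦ ?_⟩
  have hA' : (0 : ℝ) < A := by exact_mod_cast hA
  have hlt : 2 * Real.pi < 2 * Real.pi + 1 / (A : ℝ) := by
    have : (0 : ℝ) < 1 / (A : ℝ) := by positivity
    linarith
  filter_upwards [hK.eventually_le_const hlt, eventually_ge_atTop 1] with n hn hn1
  have hb := co2l_negLog_pTwo_aspect_le hn1 (h₂ n hn1) A
  have hp := co_pTwo_pos hn1 (A * n)
  have hG : -Real.log (pTwo (A * n) n) ≤ ((A : ℝ) + 1) * (2 * Real.pi + 1 / (A : ℝ)) :=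
    hb.trans (mul_le_mul_of_nonneg_left hn (by positivity))
  calc Real.exp (-(((A : ℝ) + 1) * (2 * Real.pi + 1 / (A : ℝ))))
      ≤ Real.exp (Real.log (pTwo (A * n) n)) := Real.exp_le_exp.mpr (by linarith)
    _ = pTwo (A * n) n := Real.exp_log hp

/-- **Registered form** (stub `co_cardyOrderTwoLower_of_kacTwo` of stmt-CriticalPhenomena-13878, lead c7; the
crux's two-cluster event inlined): the γ₂-half of the crux — `−log p₂(m,n)/m → γ₂(n)` for every width
`n ≥ 1` and `n·γ₂(n) → 2π` — IMPLIES the plain Cardy-order lower bound: there is `G : ℕ → ℝ` with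
`G(A)/A → 2π` and, for every integer aspect ratio `A ≥ 1`, `exp(−G(A)) ≤ p₂(A·n, n)` eventually in `n`
(= `co2l_cardyOrderTwoLower`; the necessary half of CO₂). [cite: Cardy1998, eq. (bb)] -/
theorem co_cardyOrderTwoLower_of_kacTwo : ∀ γ₂ : ℕ → ℝ, (∀ n : ℕ, 1 ≤ n → Tendsto (fun m : ℕ ↦ -Real.log ((bondPercolation (zdGraph 2) half).real {ω | ∃ x₁ ∈ (leftSide m n : Set (Site 2)), ∃ y₁ ∈ (rightSide m n : Set (Site 2)), ∃ x₂ ∈ (leftSide m n : Set (Site 2)), ∃ y₂ ∈ (rightSide m n : Set (Site 2)), ω ∈ openConnIn (rectangle m n : Set (Site 2)) x₁ y₁ ∧ ω ∈ openConnIn (rectangle m n : Set (Site 2)) x₂ y₂ ∧ ω ∉ openConnIn (rectangle m n : Set (Site 2)) x₁ x₂}) / (m : ℝ)) atTop (𝓝 (γ₂ n))) → Tendsto (fun n : ℕ ↦ (n : ℝ) * γ₂ n) atTop (𝓝 (2 * Real.pi)) → ∃ G : ℕ → ℝ, Tendsto (fun A : ℕ ↦ G A / A) atTop (𝓝 (2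 * Real.pi)) ∧ ∀ A : ℕ, 1 ≤ A → ∀ᶠ n : ℕ in atTop, Real.exp (-G A) ≤ (bondPercolation (zdGraph 2) half).real {ω | ∃ x₁ ∈ (leftSide (A * n) n : Set (Site 2)), ∃ y₁ ∈ (rightSide (A * n) n : Set (Site 2)), ∃ x₂ ∈ (leftSide (A * n) n : Set (Site 2)), ∃ y₂ ∈ (rightSide (A * n) n : Set (Site 2)), ω ∈ openConnIn (rectangle (A * n) n : Set (Site 2)) x₁ y₁ ∧ ω ∈ openConnIn (rectangle (A * n) n : Set (Site 2)) x₂ y₂ ∧ ω ∉ openConnIn (rectangle (A * n) n : Set (Site 2)) x₁ x₂} :=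
  fun _ h₂ hK => co2l_cardyOrderTwoLower h₂ hK

end Summit.CriticalPhenomena.CardyFormulaZ2.Cruxes.StripClusterRates.TwoClusterRateIsStationaryGap

end
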